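import Literature.Algebra.Lie.LefschetzModuleAdjoint
import Literature.Algebra.Lie.LefschetzTripleTransport
import HarnessLib

/-!
# Lefschetz modules up to isomorphism: the grading, the Lefschetz property, `𝔤(𝔞, M)` and the Lefschetz-module
# structure are transported along a linear isomorphism `Φ : M ≃ N` (Looijenga–Lunts 1997, §1 (1.1), (1.2), (1.7))

[topic Algebra/Lie]

Topic `Literature/Algebra/Lie` (namespace `Literature.Algebra.Lie`).  Lane `lit-hodgefound` (Track 2 foundations
library), skeleton seat `lit-hodgefound-skel-1` (generation 45), row **A1-142** of
`run/shared/lean/pub/lit-hodgefound/SKELETON.md`.  THEOREMS and ONE definition (`lefschetzLieAlgebraMapEquiv`, the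
induced isomorphism of Lie algebras); no named fact, no instance, no notation, no `sorry` (D-0026 net debt `0`).

THE POINT.  Looijenga–Lunts work with Lefschetz modules "up to isomorphism" throughout: (1.1) "This `f` is then unique"
(so everything attached to `(M, h, 𝔞)` is functorial under isomorphisms), (1.2) "`M ≅ M' ⊗ M''` as Lefschetz
`𝔞`-modules with `𝔤'` resp. `𝔤''` corresponding to `𝔤(𝔞, M')` resp. `𝔤(𝔞, M'')`", (1.7) "the adjoint action of
`MT(M)` on `𝔤𝔩(M)` leaves `𝔤(𝔞, M)` invariant", §2 (2.6) "isomorphism class of Jordan–Lefschetz pairs".  The tree's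
notion `IsLefschetzModule K h 𝔞` (A1-88, `LefschetzModule.lean`) takes `𝔞 ⊆ 𝔤𝔩(M)` literally, so every identification
of a module with another space (`M' ⊕ M'' ≅ M'' ⊕ M'`, Künneth `H(X × Y) ≅ H(X) ⊗ H(Y)`, `Hom(M', M'') ≅ M'^∨ ⊗ M''`,
extension to an `n`-fold sum …) needs the transport proved here: along a linear isomorphism `Φ : M ≃ₗ[K] N`, with
`Φ h Φ⁻¹ = Φ.conj h` and `Φ 𝔞 Φ⁻¹ = 𝔞.map Φ.conj` (Mathlib's `LinearEquiv.conj`, and its Lie-algebra form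
`LinearEquiv.lieConj : 𝔤𝔩(M) ≃ₗ⁅K⁆ 𝔤𝔩(N)`).  Row A1-87 (`LefschetzTripleTransport.lean`) did this for Lefschetz TRIPLES
along an isomorphism of Lie algebras `e : L ≃ₗ⁅K⁆ L'` (gradings `𝔤_k`, `𝔰𝔩₂`-triples, the domain and the image of `f`);
§1 below completes it by the generated Lie algebra `𝔤(h, 𝔞)` itself, and §§2–4 are the module level.

## Sources, VERBATIM (held text `paper:arxiv-alg-geom_9604014`, page/line numbers of that text)

> (§1 (1.1), p0004 L3–L4) "… the existence of `K`-linear transformation `f` in `M` of degree `-2` such that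
> `[e, f] = h`. This `f` is then unique".
> (§1 (1.2) Lemma, p0004 L98–L100) "there exist irreducible Lefschetz `𝔞`-modules `M'` and `M''` such that
> `M ≅ M' ⊗ M''` as Lefschetz `𝔞`-modules with `𝔤'` resp. `𝔤''` corresponding to `𝔤(𝔞, M')` resp. `𝔤(𝔞, M'')`."
> (§1 (1.7), p0006 L43–L44) "This shows in particular that the adjoint action of `MT(M)` on `𝔤𝔩(M)` leaves
> `𝔤(𝔞, M)` invariant."

## What is formalised (`e : L ≃ₗ⁅K⁆ L'`; `Φ : M ≃ₗ[K] N`)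

* §1 (any isomorphism of Lie algebras) **`map_lefschetzLieAlgebra_lieEquiv`**: `e(𝔤(h, 𝔞)) = 𝔤(e h, e 𝔞)` (A1-101
  `map_lieSpan` + A1-87 `image_lefschetzDuals`); `apply_mem_lefschetzLieAlgebra_iff`, `mem_lefschetzLieAlgebra_map_iff`;
  the definition **`lefschetzLieAlgebraMapEquiv e h 𝔞 : 𝔤(h, 𝔞) ≃ₗ⁅K⁆ 𝔤(e h, e 𝔞)`** (Mathlib `LieEquiv.ofSubalgebras`)
  with `coe_lefschetzLieAlgebraMapEquiv_apply`; `isSemisimple_lefschetzLieAlgebra_map_lieEquiv`.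
* §2 (`𝔤𝔩`-level, any commutative ring; `Φ h Φ⁻¹ = Φ.conj h = Φ.lieConj h`) `mem_degreeSpace_conj_iff`,
  **`map_degreeSpace_conj`** (`Φ M_k = N_k` for `Φ h Φ⁻¹`), `bijOn_degreeSpace_conj`, **`IsZGrading.conj`** /
  `isZGrading_conj_iff`, **`HasLefschetzProperty.conj`** / `hasLefschetzProperty_conj_iff`, `map_primitiveSpace_conj`
  (`Φ P_{-k} = P'_{-k}`), `depth_conj` (over a field).
* §3 **`map_lefschetzLieAlgebra_conj`** (`Φ 𝔤(𝔞, M) Φ⁻¹ = 𝔤(Φ𝔞Φ⁻¹, N)`),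
  `conj_mem_lefschetzLieAlgebra_iff`, `image_lefschetzDuals_conj`, `conj_mem_lefschetzDomain_iff`, `isSl2Triple_conj_iff'`,
  and the consumer form `lefschetzLieAlgebra_eq_map_of_linearEquiv` (hypotheses `Φ ∘ h = h' ∘ Φ`, `𝔞.map Φ.conj = 𝔞'`).
* §4 (field of characteristic `0`, finite dimension) **`IsLefschetzModule.conj`**: `(Φ𝔞Φ⁻¹, N)` is a Lefschetz module
  for `Φ h Φ⁻¹` when `(𝔞, M)` is one for `h`; `isLefschetzModule_conj_iff`; the consumer form
  **`IsLefschetzModule.of_linearEquiv`**.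

## SCOPE (not formalised here)

Transport of the particular operators attached to a Lefschetz module (`ᶜΛ`, `*_L`, `w`, …) is
`LefschetzModuleTransport.lean` (`HasLefschetzProperty.conj_dual_eq` etc., over a semiconjugating map, even across a
field extension); transport of Lefschetz triples / pairs along `L ≃ₗ⁅K⁆ L'` is A1-87.  No Hodge structures, no
Mumford–Tate group (for (1.7) proper see `LefschetzModulePolarization.lean` §9, automorphisms `u : M ≃ M` normalising
`𝔞`).

## References

* [LooijengaLunts1997] E. Looijenga, V. A. Lunts, *A Lie algebra attached to a projective variety*, Invent. Math. 129
  (1997) 361–412; arXiv:alg-geom/9604014. §1 (1.1) p. 4 L3–L4, (1.2) p. 4 L98–L100, (1.7) p. 6 L43–L44 (held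
  `paper:arxiv-alg-geom_9604014`).
-/

noncomputable section

namespace Literature.Algebra.Lie

open Module Function Set

-- The commutator Lie ring of `𝔤𝔩(M) = Module.End K M`: Mathlib's reducible NON-instance `LieRing.ofAssociativeRing`,
-- enabled file-locally exactly as in `LefschetzModule.lean` and every file of the series.
attribute [local instance 100] LieRing.ofAssociativeRing

/-! ### §1 `e(𝔤(h, 𝔞)) = 𝔤(e h, e 𝔞)` for an isomorphism of Lie algebras -/

section LieEquiv

variable {K : Type*} [CommRing K] {L L' : Type*} [LieRing L] [LieAlgebra K L] [LieRing L'] [LieAlgebra K L']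
  (e : L ≃ₗ⁅K⁆ L')

/-- `e` maps the generating set `𝔞 ∪ (image of f)` of `𝔤(h, 𝔞)` onto that of `𝔤(e h, e 𝔞)` (A1-87).
[cite: LooijengaLunts1997, §1 (1.1) p0004 L35–L37 ("generated by the transformations e_a, f_a"), §2 (2.6)] -/
theorem image_union_lefschetzDuals (h : L) (𝔞 : Submodule K L) :
    e '' ((𝔞 : Set L) ∪ lefschetzDuals K h 𝔞) =
      (𝔞.map (e : L ≃ₗ[K] L').toLinearMap : Set L') ∪ lefschetzDuals K (e h) (𝔞.map (e : L ≃ₗ[K] L').toLinearMap) := by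
  rw [Set.image_union, image_coe_submodule, image_lefschetzDuals]

/-- **`e(𝔤(h, 𝔞)) = 𝔤(e h, e 𝔞)`**: an isomorphism of Lie algebras maps the Lie subalgebra generated by `𝔞` and the
partners of its Lefschetz elements onto the one generated by `e 𝔞` and its partners ("`𝔤'` corresponding to
`𝔤(𝔞, M')`"). [cite: LooijengaLunts1997, §1 (1.2) p0004 L98–L100, (1.1) p0004 L3–L4 ("This f is then unique")] -/
theorem map_lefschetzLieAlgebra_lieEquiv (h : L) (𝔞 : Submodule K L) :
    (lefschetzLieAlgebra K h 𝔞).map e.toLieHom = lefschetzLieAlgebra K (e h) (𝔞.map (e : L ≃ₗ[K] L').toLinearMap) := by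
  rw [lefschetzLieAlgebra, lefschetzLieAlgebra, map_lieSpan]
  congr 1
  exact image_union_lefschetzDuals e h 𝔞

/-- `e x ∈ 𝔤(e h, e 𝔞) ↔ x ∈ 𝔤(h, 𝔞)`. [cite: LooijengaLunts1997, §1 (1.2) p0004 L98–L100] -/
theorem apply_mem_lefschetzLieAlgebra_iff (h : L) (𝔞 : Submodule K L) (x : L) :
    e x ∈ lefschetzLieAlgebra K (e h) (𝔞.map (e : L ≃ₗ[K] L').toLinearMap) ↔ x ∈ lefschetzLieAlgebra K h 𝔞 := by
  rw [← map_lefschetzLieAlgebra_lieEquiv, LieSubalgebra.mem_map]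
  constructor
  · rintro ⟨y, hy, hyx⟩
    rwa [← e.injective hyx]
  · exact fun hx ↦ ⟨x, hx, rfl⟩

/-- `x' ∈ 𝔤(e h, e 𝔞) ↔ e⁻¹ x' ∈ 𝔤(h, 𝔞)`. [cite: LooijengaLunts1997, §1 (1.2) p0004 L98–L100] -/
theorem mem_lefschetzLieAlgebra_map_iff (h : L) (𝔞 : Submodule K L) (x' : L') :
    x' ∈ lefschetzLieAlgebra K (e h) (𝔞.map (e : L ≃ₗ[K] L').toLinearMap) ↔ e.symm x' ∈ lefschetzLieAlgebra K h 𝔞 := by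
  rw [← apply_mem_lefschetzLieAlgebra_iff e h 𝔞 (e.symm x'), e.apply_symm_apply]

/-- **The induced isomorphism of Lie algebras `𝔤(h, 𝔞) ≃ 𝔤(e h, e 𝔞)`** (restriction of `e`; "with `𝔤'` resp. `𝔤''`
corresponding to `𝔤(𝔞, M')` resp. `𝔤(𝔞, M'')`"). [cite: LooijengaLunts1997, §1 (1.2) p0004 L98–L100] -/
def lefschetzLieAlgebraMapEquiv (h : L) (𝔞 : Submodule K L) :
    lefschetzLieAlgebra K h 𝔞 ≃ₗ⁅K⁆ lefschetzLieAlgebra K (e h) (𝔞.map (e : L ≃ₗ[K] L').toLinearMap) :=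
  e.ofSubalgebras _ _ (map_lefschetzLieAlgebra_lieEquiv e h 𝔞)

/-- The induced isomorphism is `e` on underlying elements. [cite: LooijengaLunts1997, §1 (1.2) p0004 L98–L100] -/
@[simp] theorem coe_lefschetzLieAlgebraMapEquiv_apply (h : L) (𝔞 : Submodule K L) (x : lefschetzLieAlgebra K h 𝔞) :
    ((lefschetzLieAlgebraMapEquiv e h 𝔞 x : lefschetzLieAlgebra K (e h) (𝔞.map (e : L ≃ₗ[K] L').toLinearMap)) : L') =
      e x :=
  rfl

end LieEquiv

section LieEquivField

variable {K : Type*} [Field K] [CharZero K] {L L' : Type*} [LieRing L] [LieAlgebra K L] [LieRing L'] [LieAlgebra K L']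
  [FiniteDimensional K L] [FiniteDimensional K L'] (e : L ≃ₗ⁅K⁆ L')

/-- **`𝔤(e h, e 𝔞)` is semisimple when `𝔤(h, 𝔞)` is** (isomorphic Lie algebras; characteristic `0`, finite dimension).
[cite: LooijengaLunts1997, §1 (1.2) p0004 L98–L100, §2 (2.6)] -/
theorem isSemisimple_lefschetzLieAlgebra_map_lieEquiv (h : L) (𝔞 : Submodule K L)
    [LieAlgebra.IsSemisimple K (lefschetzLieAlgebra K h 𝔞)] :
    LieAlgebra.IsSemisimple K (lefschetzLieAlgebra K (e h) (𝔞.map (e : L ≃ₗ[K] L').toLinearMap)) := by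
  haveI : FiniteDimensional K (lefschetzLieAlgebra K h 𝔞) :=
    inferInstanceAs (FiniteDimensional K (lefschetzLieAlgebra K h 𝔞).toSubmodule)
  haveI : FiniteDimensional K (lefschetzLieAlgebra K (e h) (𝔞.map (e : L ≃ₗ[K] L').toLinearMap)) :=
    inferInstanceAs (FiniteDimensional K (lefschetzLieAlgebra K (e h) (𝔞.map (e : L ≃ₗ[K] L').toLinearMap)).toSubmodule)
  exact isSemisimple_of_lieEquiv (lefschetzLieAlgebraMapEquiv e h 𝔞)

end LieEquivField

/-! ### §2 Conjugation by `Φ : M ≃ N` on `𝔤𝔩`: degrees, gradings, the Lefschetz property, primitive parts, depth -/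

section Conj

variable {K : Type*} [CommRing K] {M N : Type*} [AddCommGroup M] [Module K M] [AddCommGroup N] [Module K N]
  (Φ : M ≃ₗ[K] N)

/-- `Φ x Φ⁻¹ = y ↔ Φ x = y Φ` (the "semiconjugation" form of the consumer-facing statements below). [folklore] -/
private theorem conj_eq_iff_comp_eq {x : Module.End K M} {y : Module.End K N} :
    Φ.conj x = y ↔ (Φ : M →ₗ[K] N) ∘ₗ x = y ∘ₗ (Φ : M →ₗ[K] N) := by
  constructor
  · rintro rfl
    ext m
    simp [LinearEquiv.conj_apply_apply]
  · intro hxy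
    ext n
    have h1 := LinearMap.congr_fun hxy (Φ.symm n)
    simp only [LinearMap.comp_apply, LinearEquiv.coe_coe, LinearEquiv.apply_symm_apply] at h1
    rw [LinearEquiv.conj_apply_apply, h1]

/-- `Φ xᵏ Φ⁻¹ = (Φ x Φ⁻¹)ᵏ`. [folklore] -/
private theorem conj_pow (x : Module.End K M) (k : ℕ) : Φ.conj (x ^ k) = Φ.conj x ^ k := by
  induction k with
  | zero => rw [pow_zero, pow_zero]; exact Φ.conj_id
  | succ k ih => rw [pow_succ, pow_succ, Module.End.mul_eq_comp, Module.End.mul_eq_comp, LinearEquiv.conj_comp, ih]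

variable {h e : Module.End K M}

/-- `y ∈ N_k` (for `Φ h Φ⁻¹`) `↔ Φ⁻¹ y ∈ M_k`. [cite: LooijengaLunts1997, §1 (1.1) p0003 L106–L111 ("multiplication by k in degree k")] -/
theorem mem_degreeSpace_conj_iff {k : ℤ} {y : N} : y ∈ degreeSpace (Φ.conj h) k ↔ Φ.symm y ∈ degreeSpace h k := by
  rw [mem_degreeSpace_iff, mem_degreeSpace_iff, LinearEquiv.conj_apply_apply]
  constructor
  · intro h1
    have h2 := congrArg Φ.symm h1
    rwa [Φ.symm_apply_apply, map_smul] at h2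
  · intro h1
    rw [h1, map_smul, Φ.apply_symm_apply]

/-- `Φ x ∈ N_k ↔ x ∈ M_k`. [cite: LooijengaLunts1997, §1 (1.1) p0003 L106–L111] -/
theorem apply_mem_degreeSpace_conj_iff {k : ℤ} {x : M} : Φ x ∈ degreeSpace (Φ.conj h) k ↔ x ∈ degreeSpace h k := by
  rw [mem_degreeSpace_conj_iff, Φ.symm_apply_apply]

/-- **`Φ M_k = N_k`**: the degree-`k` part for `Φ h Φ⁻¹` is the image of the degree-`k` part for `h`.
[cite: LooijengaLunts1997, §1 (1.1) p0003 L106–L111, (1.2) p0004 L98–L100] -/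
theorem map_degreeSpace_conj (h : Module.End K M) (k : ℤ) :
    (degreeSpace h k).map (Φ : M →ₗ[K] N) = degreeSpace (Φ.conj h) k := by
  ext y
  rw [Submodule.mem_map_equiv, mem_degreeSpace_conj_iff]

/-- `Φ` is a bijection `M_k → N_k`. [cite: LooijengaLunts1997, §1 (1.1) p0003 L106–L111] -/
theorem bijOn_degreeSpace_conj (h : Module.End K M) (k : ℤ) :
    BijOn Φ (degreeSpace h k) (degreeSpace (Φ.conj h) k) := by
  have hs : (Φ : M → N) '' (degreeSpace h k : Set M) = (degreeSpace (Φ.conj h) k : Set N) := by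
    rw [← map_degreeSpace_conj, Submodule.map_coe, LinearEquiv.coe_coe]
  rw [← hs]
  exact (Φ.injective.injOn).bijOn_image

/-- `Φ⁻¹` is a bijection `N_k → M_k`. [cite: LooijengaLunts1997, §1 (1.1) p0003 L106–L111] -/
theorem bijOn_symm_degreeSpace_conj (h : Module.End K M) (k : ℤ) :
    BijOn Φ.symm (degreeSpace (Φ.conj h) k) (degreeSpace h k) := by
  have h1 := bijOn_degreeSpace_conj Φ.symm (Φ.conj h) k
  rwa [LinearEquiv.conj_symm_conj] at h1

/-- `ker(Φ x Φ⁻¹) = Φ ker(x)`. [folklore] -/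
private theorem ker_conj (x : Module.End K M) : LinearMap.ker (Φ.conj x) = (LinearMap.ker x).map (Φ : M →ₗ[K] N) := by
  ext y
  rw [Submodule.mem_map_equiv, LinearMap.mem_ker, LinearMap.mem_ker, LinearEquiv.conj_apply_apply,
    map_eq_zero_iff Φ Φ.injective]

/-- **`(N, Φ h Φ⁻¹)` is `ℤ`-graded when `(M, h)` is.** [cite: LooijengaLunts1997, §1 (1.1) p0003 L106–L111, (1.2) p0004 L98–L100] -/
theorem IsZGrading.conj (hgr : IsZGrading h) : IsZGrading (Φ.conj h) := by
  rw [IsZGrading] at hgr ⊢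
  simp_rw [← map_degreeSpace_conj Φ h]
  rw [← Submodule.map_iSup, hgr, Submodule.map_top, LinearEquiv.range]

/-- … and conversely. [cite: LooijengaLunts1997, §1 (1.1) p0003 L106–L111] -/
theorem isZGrading_conj_iff : IsZGrading (Φ.conj h) ↔ IsZGrading h := by
  refine ⟨fun hgr ↦ ?_, fun hgr ↦ hgr.conj Φ⟩
  have h1 := hgr.conj Φ.symm
  rwa [LinearEquiv.conj_symm_conj] at h1

/-- **The Lefschetz property is invariant under isomorphism: `Φ e Φ⁻¹` has it for `Φ h Φ⁻¹` when `e` has it for `h`**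
("`e^k` maps `M_{-k}` isomorphically onto `M_k`" is transported degree by degree).
[cite: LooijengaLunts1997, §1 (1.1) p0004 L1–L4, (1.2) p0004 L98–L100] -/
theorem HasLefschetzProperty.conj (L : HasLefschetzProperty h e) : HasLefschetzProperty (Φ.conj h) (Φ.conj e) where
  mapsTo k := by
    intro y hy
    rw [SetLike.mem_coe, mem_degreeSpace_conj_iff] at hy ⊢
    rw [LinearEquiv.conj_apply_apply, Φ.symm_apply_apply]
    exact L.mapsTo k hy
  bijOn k := by
    have h1 := ((bijOn_degreeSpace_conj Φ h k).comp (L.bijOn k)).comp (bijOn_symm_degreeSpace_conj Φ h (-(k : ℤ)))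
    refine h1.congr fun y _ ↦ ?_
    rw [← conj_pow, Function.comp_apply, Function.comp_apply, LinearEquiv.conj_apply_apply]

/-- … and conversely. [cite: LooijengaLunts1997, §1 (1.1) p0004 L1–L4] -/
theorem hasLefschetzProperty_conj_iff : HasLefschetzProperty (Φ.conj h) (Φ.conj e) ↔ HasLefschetzProperty h e := by
  refine ⟨fun L ↦ ?_, fun L ↦ L.conj Φ⟩
  have h1 := L.conj Φ.symm
  rwa [LinearEquiv.conj_symm_conj, LinearEquiv.conj_symm_conj] at h1

/-- **`Φ P_{-k}(M) = P_{-k}(N)`**: primitive parts correspond (`P_{-k} = M_{-k} ∩ ker e^{k+1}`).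
[cite: LooijengaLunts1997, §2 (2.2) ("the primitive decomposition"), §1 (1.2) p0004 L98–L100] -/
theorem map_primitiveSpace_conj (h e : Module.End K M) (k : ℕ) :
    (HasLefschetzProperty.primitiveSpace h e k).map (Φ : M →ₗ[K] N) =
      HasLefschetzProperty.primitiveSpace (Φ.conj h) (Φ.conj e) k := by
  rw [HasLefschetzProperty.primitiveSpace, HasLefschetzProperty.primitiveSpace, Submodule.map_inf _ Φ.injective,
    map_degreeSpace_conj, ← conj_pow, ker_conj]

/-- `N_k ≠ 0 ↔ M_k ≠ 0`. [cite: LooijengaLunts1997, §1 (1.1) p0004 L58–L60 ("the greatest integer n with M_n ≠ 0")] -/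
theorem degreeSpace_conj_ne_bot_iff {k : ℤ} : degreeSpace (Φ.conj h) k ≠ ⊥ ↔ degreeSpace h k ≠ ⊥ := by
  rw [← map_degreeSpace_conj, Submodule.map_ne_bot_iff]

end Conj

section ConjField

variable {K : Type*} [Field K] {M N : Type*} [AddCommGroup M] [Module K M] [AddCommGroup N] [Module K N]
  (Φ : M ≃ₗ[K] N)

/-- **The depth is invariant: `depth (Φ h Φ⁻¹) = depth h`.** [cite: LooijengaLunts1997, §1 (1.1) p0004 L58–L60] -/
theorem depth_conj (h : Module.End K M) : depth (Φ.conj h) = depth h := by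
  rw [depth, depth]
  congr 1
  ext n
  exact degreeSpace_conj_ne_bot_iff Φ

end ConjField

/-! ### §3 `Φ 𝔤(𝔞, M) Φ⁻¹ = 𝔤(Φ𝔞Φ⁻¹, N)` -/

section ConjLie

variable {K : Type*} [CommRing K] {M N : Type*} [AddCommGroup M] [Module K M] [AddCommGroup N] [Module K N]
  (Φ : M ≃ₗ[K] N)

/-- **`Φ 𝔤(𝔞, M) Φ⁻¹ = 𝔤(Φ𝔞Φ⁻¹, N)`** (for the degree operators `h` and `Φ h Φ⁻¹`): §1 for `e = Φ.lieConj`.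
[cite: LooijengaLunts1997, §1 (1.2) p0004 L98–L100, (1.7) p0006 L43–L44] -/
theorem map_lefschetzLieAlgebra_conj (h : Module.End K M) (𝔞 : Submodule K (Module.End K M)) :
    (lefschetzLieAlgebra K h 𝔞).map Φ.lieConj.toLieHom = lefschetzLieAlgebra K (Φ.conj h) (𝔞.map Φ.conj.toLinearMap) :=
  map_lefschetzLieAlgebra_lieEquiv Φ.lieConj h 𝔞

/-- `Φ x Φ⁻¹ ∈ 𝔤(Φ𝔞Φ⁻¹, N) ↔ x ∈ 𝔤(𝔞, M)`. [cite: LooijengaLunts1997, §1 (1.2) p0004 L98–L100] -/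
theorem conj_mem_lefschetzLieAlgebra_iff (h : Module.End K M) (𝔞 : Submodule K (Module.End K M)) (x : Module.End K M) :
    Φ.conj x ∈ lefschetzLieAlgebra K (Φ.conj h) (𝔞.map Φ.conj.toLinearMap) ↔ x ∈ lefschetzLieAlgebra K h 𝔞 :=
  apply_mem_lefschetzLieAlgebra_iff Φ.lieConj h 𝔞 x

/-- `Φ (image of f) Φ⁻¹ = image of f` of `(Φ h Φ⁻¹, Φ𝔞Φ⁻¹)` (A1-87 for `e = Φ.lieConj`).
[cite: LooijengaLunts1997, §1 (1.1) p0004 L3–L4 ("This f is then unique")] -/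
theorem image_lefschetzDuals_conj (h : Module.End K M) (𝔞 : Submodule K (Module.End K M)) :
    Φ.conj '' lefschetzDuals K h 𝔞 = lefschetzDuals K (Φ.conj h) (𝔞.map Φ.conj.toLinearMap) :=
  image_lefschetzDuals Φ.lieConj h 𝔞

/-- `Φ a Φ⁻¹` is in the domain of `f` of `(Φ h Φ⁻¹, Φ𝔞Φ⁻¹)` iff `a` is in the domain of `f` of `(h, 𝔞)`.
[cite: LooijengaLunts1997, §1 (1.1) p0004 L3–L4] -/
theorem conj_mem_lefschetzDomain_iff (h : Module.End K M) (𝔞 : Submodule K (Module.End K M)) (a : Module.End K M) :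
    Φ.conj a ∈ lefschetzDomain K (Φ.conj h) (𝔞.map Φ.conj.toLinearMap) ↔ a ∈ lefschetzDomain K h 𝔞 :=
  apply_mem_lefschetzDomain_iff Φ.lieConj h 𝔞 a

/-- `(Φ e Φ⁻¹, Φ h Φ⁻¹, Φ f Φ⁻¹)` is an `𝔰𝔩₂`-triple of `𝔤𝔩(N)` iff `(e, h, f)` is one of `𝔤𝔩(M)`.
[cite: LooijengaLunts1997, §1 (1.1) p0004 L3–L5] -/
theorem isSl2Triple_conj_iff' {h e f : Module.End K M} :
    IsSl2Triple (Φ.conj h) (Φ.conj e) (Φ.conj f) ↔ IsSl2Triple h e f :=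
  isSl2Triple_map_iff Φ.lieConj

/-- **Consumer form of §3**: `𝔤(𝔞', N) = Φ 𝔤(𝔞, M) Φ⁻¹` whenever `Φ h = h' Φ` and `𝔞' = Φ 𝔞 Φ⁻¹`.
[cite: LooijengaLunts1997, §1 (1.2) p0004 L98–L100] -/
theorem lefschetzLieAlgebra_eq_map_of_linearEquiv {h : Module.End K M} {𝔞 : Submodule K (Module.End K M)}
    {h' : Module.End K N} {𝔞' : Submodule K (Module.End K N)} (hh : (Φ : M →ₗ[K] N) ∘ₗ h = h' ∘ₗ (Φ : M →ₗ[K] N))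
    (h𝔞 : 𝔞.map Φ.conj.toLinearMap = 𝔞') :
    lefschetzLieAlgebra K h' 𝔞' = (lefschetzLieAlgebra K h 𝔞).map Φ.lieConj.toLieHom := by
  rw [← h𝔞, ← (conj_eq_iff_comp_eq Φ).2 hh, map_lefschetzLieAlgebra_conj]

end ConjLie

/-! ### §4 Lefschetz modules are transported along linear isomorphisms -/

section Module

variable {K : Type*} [Field K] [CharZero K] {M N : Type*} [AddCommGroup M] [Module K M] [FiniteDimensional K M]
  [AddCommGroup N] [Module K N] [FiniteDimensional K N] (Φ : M ≃ₗ[K] N)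
  {h : Module.End K M} {𝔞 : Submodule K (Module.End K M)}

/-- **`(Φ𝔞Φ⁻¹, N)` IS A LEFSCHETZ MODULE (for the degree operator `Φ h Φ⁻¹`) when `(𝔞, M)` is one for `h`**: the
grading, degree-`2`, commutation and Lefschetz-domain conditions are transported by §§2–3, and
`𝔤(Φ𝔞Φ⁻¹, N) = Φ 𝔤(𝔞, M) Φ⁻¹ ≅ 𝔤(𝔞, M)` is semisimple (§1).
[cite: LooijengaLunts1997, §1 (1.2) p0004 L98–L100 ("M ≅ M′ ⊗ M″ as Lefschetz 𝔞-modules with 𝔤′ … corresponding to 𝔤(𝔞, M′)"), (1.1) p0004 L3–L4] -/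
theorem IsLefschetzModule.conj (A : IsLefschetzModule K h 𝔞) :
    IsLefschetzModule K (Φ.conj h) (𝔞.map Φ.conj.toLinearMap) where
  isZGrading := A.isZGrading.conj Φ
  le_adDegree_two := by
    rintro _ ⟨a, ha, rfl⟩
    exact (apply_mem_adDegree_iff Φ.lieConj h a 2).2 (A.le_adDegree_two ha)
  lie_eq_zero := by
    rintro _ ⟨a, ha, rfl⟩ _ ⟨b, hb, rfl⟩
    show ⁅Φ.lieConj a, Φ.lieConj b⁆ = 0
    rw [← LieEquiv.map_lie, A.lie_eq_zero a ha b hb, map_zero]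
  nonempty_lefschetzDomain := by
    obtain ⟨a, ha⟩ := A.nonempty_lefschetzDomain
    exact ⟨Φ.conj a, (conj_mem_lefschetzDomain_iff Φ h 𝔞 a).2 ha⟩
  isSemisimple := by
    haveI := A.isSemisimple
    exact isSemisimple_lefschetzLieAlgebra_map_lieEquiv Φ.lieConj h 𝔞

/-- … and conversely: `(Φ𝔞Φ⁻¹, N)` is a Lefschetz module iff `(𝔞, M)` is. [cite: LooijengaLunts1997, §1 (1.2) p0004 L98–L100] -/
theorem isLefschetzModule_conj_iff :
    IsLefschetzModule K (Φ.conj h) (𝔞.map Φ.conj.toLinearMap) ↔ IsLefschetzModule K h 𝔞 := by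
  refine ⟨fun A ↦ ?_, fun A ↦ A.conj Φ⟩
  have A' := A.conj Φ.symm
  have h1 : Φ.symm.conj.toLinearMap ∘ₗ Φ.conj.toLinearMap = LinearMap.id := by
    refine LinearMap.ext fun x ↦ ?_
    simp
  have h𝔞 : (𝔞.map Φ.conj.toLinearMap).map Φ.symm.conj.toLinearMap = 𝔞 := by
    rw [← Submodule.map_comp, h1, Submodule.map_id]
  rwa [LinearEquiv.conj_symm_conj, h𝔞] at A'

/-- **Consumer form**: a Lefschetz module `(𝔞, M)` for `h` and a linear isomorphism `Φ : M ≃ N` with `Φ h = h' Φ`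
make `(𝔞', N)` a Lefschetz module for `h'` as soon as `𝔞' = Φ 𝔞 Φ⁻¹` (e.g. Künneth and Poincaré identifications).
[cite: LooijengaLunts1997, §1 (1.2) p0004 L98–L100] -/
theorem IsLefschetzModule.of_linearEquiv (A : IsLefschetzModule K h 𝔞) {h' : Module.End K N}
    {𝔞' : Submodule K (Module.End K N)} (hh : (Φ : M →ₗ[K] N) ∘ₗ h = h' ∘ₗ (Φ : M →ₗ[K] N))
    (h𝔞 : 𝔞.map Φ.conj.toLinearMap = 𝔞') : IsLefschetzModule K h' 𝔞' := by
  rw [← h𝔞, ← (conj_eq_iff_comp_eq Φ).2 hh]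
  exact A.conj Φ

end Module

end Literature.Algebra.Lie
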